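import Mathlib.NumberTheory.Chebyshev
import Mathlib.NumberTheory.LSeries.RiemannZeta
import Mathlib.NumberTheory.Harmonic.EulerMascheroni
import Mathlib.Analysis.Real.Pi.Bounds
import HarnessLib

/-!
# Mertens' product against `log θ(x)` under RH (Nicolas 1983, 2012) and Schoenfeld's `θ`-bound

Topic: `Literature/NumberTheory/LFunctions`. Four named facts (`def … : Prop`, nothing asserted)
that are the analytic inputs of Robin's criterion `Literature.NumberTheory.LFunctions.robin_iff` (`RHClassicalEquivalents.lean`;
architecture in `RobinCriterion.lean`, provefact `Literature.NumberTheory.LFunctions.robin_iff`), taken from sources that are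
held and print them with explicit constants:

* `Nicolas2012_logf_lower` — J.-L. Nicolas, *Small values of the Euler function and the Riemann
  hypothesis*, Acta Arith. 155 (2012), Prop. 2.1 and its proof (p. 316 of the journal = p. 5 of
  arXiv:1202.0729): under RH, for `x ≥ x₀ = 10⁹`, with
  `f(x) = e^γ log θ(x) ∏_{p ≤ x} (1 − 1/p)` ((1.9)) and `v = −log f(x)`,
  "`v ≤ (W(x)+2)/(√x log x) ≤ (2+β)/(√x log x)`", where `W(x) = ∑_ρ x^{i Im ρ}/(ρ(1−ρ))`,
  `|W(x)| ≤ β` ((1.19)) and `β = ∑_ρ 1/(ρ(1−ρ)) = 2 + γ − log π − 2 log 2 = 0.0461914179…` ((1.3)).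
  We vendor the displayed `W`-free consequence `−log f(x) ≤ (2+β)/(√x log x)` with `β` as the
  printed closed form (`nicolasBeta`), so that no vocabulary for sums over zeta zeros is needed.
  This is the effective form, under RH, of Mertens' theorem measured against `log θ(x)` rather
  than `log x` — the "Mertens-product lemma" of Robin 1984, §3 (there for `x ≥ 20000`), whose
  proof (Nicolas 1983, Prop. 1 = Nicolas 2012, Lemma 2.1; explicit formula for `∫ (ψ(t) − t)`,
  Lemma 2.5) is not in Mathlib.
* `Nicolas2012_logf_lower_sharp` — the same paper, display (2.18) in the proof of Prop. 2.1
  (arXiv numbering), valid for `x ≥ 599` under RH: the lower bound for `log f(x)` with its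
  second-order terms, `−(W+2)/(√x log x) + (2−β)/(√x log² x) − (8+4β)/(√x log³ x) − log(2π)/(x log x)
  − 2/(x^{2/3} log x) − log³ x/(64π² x) ≤ log f(x)`, vendored `W`-free through `|W(x)| ≤ β`
  ((1.19)). The `x ≥ 10⁹` fact `Nicolas2012_logf_lower` is now DERIVED from it
  (`Nicolas2012_logf_lower_of_sharp`, replaying Nicolas's step (2.18) ⟹ (2.20) ⟹ (2.16)).
* `Schoenfeld1976_theta` — L. Schoenfeld, Math. Comp. 30 (1976), §6: under RH,
  `|θ(x) − x| ≤ √x log²x /(8π)` for `x ≥ 599`; statement as printed in Nicolas 2012, (1.12)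
  ("Under RH, we shall use the upper bound (cf. [Sch76]) `x ≥ 599 ⟹ |S(x)| ≤ T(x) = (1/8π)√x log²x`",
  `S = θ − x`) and in Büthe, arXiv:1410.7015, §7. (The `π(x) − li(x)` form, Schoenfeld's Cor. 1
  (6.18), is `Literature.NumberTheory.LFunctions.schoenfeld_explicit` in `RHConditionalFacts.lean`.)
* `Nicolas1983_logf_omega` — Nicolas 1983 (J. Number Theory 17), as restated in Nicolas 2012,
  (1.10): "if RH fails, there exists `b`, `0 < b < 1/2`, such that `log f(x) = Ω_±(x^{−b})`".
  This is the input of the converse half of Robin's criterion (Robin 1984, §4, Prop. 1 transfers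
  it from `n/φ(n)` at primorials to `σ(n)/n` at colossally abundant numbers).

Small proved API: `nicolasF_pos` (so that `log f(x)` is a genuine logarithm for `x ≥ 3`) and the
product form `Nicolas2012_logf_lower.prod_le`:
`∏_{p ≤ x} (1 − 1/p)⁻¹ ≤ e^γ · log θ(x) · exp((2+β)/(√x log x))` for `x ≥ 10⁹` under RH.

## References

* J.-L. Nicolas, *Small values of the Euler function and the Riemann hypothesis*, Acta Arith. 155
  (2012), 311–321 (arXiv:1202.0729; equation numbers as in the arXiv version): (1.3), (1.9),
  (1.10), (1.12), (1.19), Lemma 2.1, Lemma 2.5 (2.14)–(2.15), Prop. 2.1 (2.16)–(2.17) and its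
  proof, displays (2.18) and (2.20). [Nicolas2012] (held)
* J.-L. Nicolas, *Petites valeurs de la fonction d'Euler*, J. Number Theory 17 (1983), 375–388:
  Prop. 1 (= Nicolas 2012, Lemma 2.1) and the `Ω_±` theorem quoted as Nicolas 2012 (1.10).
  [Nicolas1983]
* L. Schoenfeld, *Sharper bounds for the Chebyshev functions θ(x) and ψ(x). II*, Math. Comp. 30
  (1976), 337–360, §6 (bounds under RH: `ψ` for `x ≥ 73.2`, `θ` for `x ≥ 599`, `π − li` for
  `x ≥ 2657`). [Schoenfeld1976]
* G. Robin, J. Math. Pures Appl. 63 (1984), 187–213, §3 (use of the two bounds), §4 Prop. 1.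
  [Robin1984]

## Mathlib

`Chebyshev.theta` (`θ`, with `theta_mono`, `theta_eq_sum_primesLE_log`), `Nat.primesLE`,
`Real.eulerMascheroniConstant`, `RiemannHypothesis`. Mathlib has Chebyshev's bounds
(`theta_le_log4_mul_x`, `theta_ge`) and crude Mertens halves, but neither Mertens' third theorem
(`∏_{p ≤ x}(1 − 1/p) ~ e^{−γ}/log x`) nor any RH-explicit prime bound.
-/

noncomputable section

open Real Filter Finset
open scoped Chebyshev

namespace Literature.NumberTheory.LFunctions

/-! ### Nicolas's `β` and `f` -/

/-- Nicolas's constant `β = 2 + γ − log π − 2 log 2 = 0.0461914179…` (Nicolas 2012, (1.3), where it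
is shown equal to `∑_ρ 1/(ρ(1−ρ))` over the non-trivial zeros, after Edwards; Robin 1984 writes
`c = γ + 2 − log 4π` for the same number). Vendored as the printed closed form.
[cite: Nicolas2012, (1.3)] -/
def nicolasBeta : ℝ :=
  2 + eulerMascheroniConstant - Real.log π - 2 * Real.log 2

/-- Nicolas's `f(x) = e^γ · log θ(x) · ∏_{p ≤ x} (1 − 1/p)` (Nicolas 2012, (1.9); Nicolas 1983), the
ratio of Mertens' product to its main term measured against `log θ(x)`; "Mertens's formula yields
`lim_{x→∞} f(x) = 1`". Here `θ = Chebyshev.theta` and the product is over `Nat.primesLE ⌊x⌋₊`.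
[cite: Nicolas2012, (1.9)] -/
def nicolasF (x : ℝ) : ℝ :=
  rexp eulerMascheroniConstant * Real.log (θ x) * ∏ p ∈ Nat.primesLE ⌊x⌋₊, (1 - (p : ℝ)⁻¹)

/-! ### The three named facts -/

/-- NAMED FACT (Nicolas 2012, Prop. 2.1 with its proof, under RH, for `x ≥ x₀ = 10⁹`: the lower
bound (2.16) `log f(x) ≥ −(2+W(x))/(√x log x) + 0.055/(√x log² x)` and `|W(x)| ≤ β` (1.19) give,
as displayed in the proof, "`v ≤ (W(x)+2)/(√x log x) ≤ (2+β)/(√x log x)`" for `v = −log f(x)`).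
Under the Riemann hypothesis, for every real `x ≥ 10⁹`,
`−log f(x) ≤ (2 + β)/(√x · log x)` with `f = nicolasF`, `β = nicolasBeta`. Equivalently
(`Nicolas2012_logf_lower.prod_le`): `∏_{p ≤ x}(1 − 1/p)⁻¹ ≤ e^γ log θ(x) · exp((2+β)/(√x log x))`.
Users take `(h : Nicolas2012_logf_lower)`.
[cite: Nicolas2012, Prop. 2.1 (2.16) and proof (display `v ≤ (2+β)/(√x log x)`), with (1.3), (1.19)] -/
def Nicolas2012_logf_lower : Prop :=
  RiemannHypothesis →
    ∀ x : ℝ, (10 : ℝ) ^ 9 ≤ x → -Real.log (nicolasF x) ≤ (2 + nicolasBeta) / (√x * Real.log x)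

/-- NAMED FACT (Schoenfeld 1976, §6, the `θ`-bound under RH; statement as printed in Nicolas 2012,
(1.12): "`x ≥ 599 ⟹ |S(x)| ≤ T(x) = (1/8π) √x log² x`", `S(x) = θ(x) − x`, and in Büthe 2015, §7).
Under the Riemann hypothesis, `|θ(x) − x| ≤ √x · log² x /(8π)` for every real `x ≥ 599`
(`θ = Chebyshev.theta`; Schoenfeld's own inequality is strict). Users take
`(h : Schoenfeld1976_theta)`.
[cite: Schoenfeld1976, §6 (θ under RH, x ≥ 599); as printed in Nicolas2012 (1.12)] -/
def Schoenfeld1976_theta : Prop :=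
  RiemannHypothesis →
    ∀ x : ℝ, 599 ≤ x → |θ x - x| ≤ √x * Real.log x ^ 2 / (8 * π)

/-- NAMED FACT (Nicolas 1983, as restated in Nicolas 2012, (1.10): "In [Nicolas 1983] it is shown
that, if RH fails, there exists `b`, `0 < b < 1/2`, such that `log f(x) = Ω_±(x^{−b})`").
If the Riemann hypothesis fails, there is `b ∈ (0, 1/2)` such that both
`log f(x) ≤ −c·x^{−b}` and `log f(x) ≥ c·x^{−b}` hold for arbitrarily large real `x`, for some
`c > 0` (`Ω₋` and `Ω₊` spelled out with `∃ᶠ x in atTop`; `f = nicolasF`). Users take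
`(h : Nicolas1983_logf_omega)`.
[cite: Nicolas1983, Ω±-theorem for log f (as restated in Nicolas2012, (1.10))] -/
def Nicolas1983_logf_omega : Prop :=
  ¬ RiemannHypothesis →
    ∃ b : ℝ, 0 < b ∧ b < 1 / 2 ∧
      (∃ c : ℝ, 0 < c ∧ ∃ᶠ x : ℝ in atTop, Real.log (nicolasF x) ≤ -c * x ^ (-b)) ∧
      (∃ c : ℝ, 0 < c ∧ ∃ᶠ x : ℝ in atTop, c * x ^ (-b) ≤ Real.log (nicolasF x))

/-! ### Elementary API -/

/-- `θ(3) = log 2 + log 3 = log 6`. [folklore] -/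
theorem theta_three : θ (3 : ℝ) = Real.log 6 := by
  have h : θ ((3 : ℕ) : ℝ) = ∑ p ∈ Nat.primesLE 3, Real.log p := Chebyshev.theta_eq_sum_primesLE_log 3
  have hset : Nat.primesLE 3 = {2, 3} := by decide
  rw [hset] at h
  rw [show ((3 : ℕ) : ℝ) = 3 by norm_num] at h
  rw [h, Finset.sum_pair (by norm_num)]
  rw [← Real.log_mul (by norm_num) (by norm_num)]
  norm_num

/-- `θ(x) > 1` for `x ≥ 3` (`θ(3) = log 6 > 1` and `θ` is monotone). [folklore] -/
theorem one_lt_theta {x : ℝ} (hx : 3 ≤ x) : 1 < θ x := by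
  have h6 : (1 : ℝ) < Real.log 6 := by
    rw [← Real.exp_lt_exp, Real.exp_log (by norm_num)]
    have := Real.exp_one_lt_d9
    linarith
  calc (1 : ℝ) < θ 3 := by rw [theta_three]; exact h6
    _ ≤ θ x := Chebyshev.theta_mono hx

/-- Each Mertens factor `1 − 1/p` is positive. [folklore] -/
theorem mertens_factor_pos {n p : ℕ} (hp : p ∈ Nat.primesLE n) : 0 < 1 - (p : ℝ)⁻¹ := by
  have hp' : p.Prime := (Nat.mem_primesLE.1 hp).2
  have h2 : (2 : ℝ) ≤ p := by exact_mod_cast hp'.two_le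
  have : (p : ℝ)⁻¹ ≤ 1 / 2 := by
    rw [inv_eq_one_div]
    exact one_div_le_one_div_of_le (by norm_num) h2
  linarith

/-- The Mertens product `∏_{p ≤ n} (1 − 1/p)` is positive. [folklore] -/
theorem mertens_prod_pos (n : ℕ) : 0 < ∏ p ∈ Nat.primesLE n, (1 - (p : ℝ)⁻¹) :=
  Finset.prod_pos fun _ hp => mertens_factor_pos hp

/-- `f(x) > 0` for `x ≥ 3`. [folklore] -/
theorem nicolasF_pos {x : ℝ} (hx : 3 ≤ x) : 0 < nicolasF x := by
  unfold nicolasF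
  refine mul_pos (mul_pos (Real.exp_pos _) (Real.log_pos (one_lt_theta hx))) (mertens_prod_pos _)

/-- Product form of Nicolas's bound: under RH, for `x ≥ 10⁹`,
`∏_{p ≤ x} (1 − 1/p)⁻¹ ≤ e^γ · log θ(x) · exp((2 + β)/(√x log x))` — the shape used by Robin 1984,
§3 (with `20000` in place of `10⁹` and a second-order term). [cite: Nicolas2012, Prop. 2.1 (2.17)] -/
theorem Nicolas2012_logf_lower.prod_le (h : Nicolas2012_logf_lower) (hRH : RiemannHypothesis)
    {x : ℝ} (hx : (10 : ℝ) ^ 9 ≤ x) :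
    (∏ p ∈ Nat.primesLE ⌊x⌋₊, (1 - (p : ℝ)⁻¹))⁻¹ ≤
      rexp eulerMascheroniConstant * Real.log (θ x) *
        rexp ((2 + nicolasBeta) / (√x * Real.log x)) := by
  have hx3 : (3 : ℝ) ≤ x := le_trans (by norm_num) hx
  have hf : 0 < nicolasF x := nicolasF_pos hx3
  have hP : 0 < ∏ p ∈ Nat.primesLE ⌊x⌋₊, (1 - (p : ℝ)⁻¹) := mertens_prod_pos _
  have hA : 0 < rexp eulerMascheroniConstant * Real.log (θ x) :=
    mul_pos (Real.exp_pos _) (Real.log_pos (one_lt_theta hx3))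
  have h1 : -Real.log (nicolasF x) ≤ (2 + nicolasBeta) / (√x * Real.log x) := h hRH x hx
  -- `1/f(x) = exp(-log f(x)) ≤ exp((2+β)/(√x log x))`
  have h2 : (nicolasF x)⁻¹ ≤ rexp ((2 + nicolasBeta) / (√x * Real.log x)) := by
    have : (nicolasF x)⁻¹ = rexp (-Real.log (nicolasF x)) := by
      rw [Real.exp_neg, Real.exp_log hf]
    rw [this]
    exact Real.exp_le_exp.2 h1
  -- `∏⁻¹ = (e^γ log θ) · f⁻¹`
  have h3 : (∏ p ∈ Nat.primesLE ⌊x⌋₊, (1 - (p : ℝ)⁻¹))⁻¹ =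
      rexp eulerMascheroniConstant * Real.log (θ x) * (nicolasF x)⁻¹ := by
    have hnf : nicolasF x = (rexp eulerMascheroniConstant * Real.log (θ x)) *
        ∏ p ∈ Nat.primesLE ⌊x⌋₊, (1 - (p : ℝ)⁻¹) := rfl
    rw [hnf, mul_inv, ← mul_assoc, mul_inv_cancel₀ hA.ne', one_mul]
  rw [h3]
  exact mul_le_mul_of_nonneg_left h2 hA.le

/-! ### Nicolas 2012, (2.18): the lower bound for `log f(x)` with its second-order terms, `x ≥ 599` -/

/-- NAMED FACT (Nicolas 2012, display (2.18) in the proof of Prop. 2.1 (arXiv numbering), under RH,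
for `x ≥ 599`: "By collecting the information from (2.1), (1.12), (2.13), (2.14), (2.15), (2.4) and
(2.5), for `x ≥ 599`, we get
`log f(x) ≥ −(W(x)+2)/(√x log x) + (2−β)/(√x log² x) − (8+4β)/(√x log³ x) − log(2π)/(x log x)
 − 2/(x^{2/3} log x) − log³ x/(64π² x)`", combined, as for `Nicolas2012_logf_lower`, with
`|W(x)| ≤ β` ((1.19)) to eliminate the sum over zeros `W`).
Under the Riemann hypothesis, for every real `x ≥ 599`,
`−(β+2)/(√x log x) + (2−β)/(√x log² x) − (8+4β)/(√x log³ x) − log(2π)/(x log x) − 2/(x^{2/3} log x)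
 − log³ x/(64π² x) ≤ log f(x)` (`f = nicolasF`, `β = nicolasBeta`). This is the inequality from which
Nicolas derives Prop. 2.1 (2.16) at `x₀ = 10⁹` via (2.20) (`Nicolas2012_logf_lower_of_sharp` below replays
that step), and the form needed to lower the threshold of `RobinAnalytic.lean`. Its printed proof:
Lemma 2.1 (= Nicolas 1983 Prop. 1, `K(x) − S²/(x² log x) ≤ log f(x)`), Schoenfeld's (1.12) for `S²`,
Cor. 2.1 (2.13) and Lemma 2.2 (2.4)–(2.5) (`J − K ≤ F_{1/2} + (4/3)F_{1/3}`), and Lemma 2.5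
(2.14)–(2.15) (explicit formula: `J = −W/(√x log x) − J₁ − J₂`). Users take `(h : Nicolas2012_logf_lower_sharp)`.
[cite: Nicolas2012, (2.18) (proof of Prop. 2.1), with (1.19)] -/
def Nicolas2012_logf_lower_sharp : Prop :=
  RiemannHypothesis →
    ∀ x : ℝ, 599 ≤ x →
      -(nicolasBeta + 2) / (√x * Real.log x) + (2 - nicolasBeta) / (√x * Real.log x ^ 2)
          - (8 + 4 * nicolasBeta) / (√x * Real.log x ^ 3) - Real.log (2 * π) / (x * Real.log x)
          - 2 / (x ^ ((2 : ℝ) / 3) * Real.log x) - Real.log x ^ 3 / (64 * π ^ 2 * x)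
        ≤ Real.log (nicolasF x)

/-! ### From (2.18) to Prop. 2.1: `Nicolas2012_logf_lower_sharp → Nicolas2012_logf_lower` -/

/-- `x ↦ (log x)^k / x^a` is non-increasing once `log x ≥ k/a` (`a > 0`, `k ≥ 1`); derivative-free
proof: with `d = log(y/x) ≥ 0`, `(1 + d/log x)^k ≤ e^{kd/log x} ≤ e^{ad} = (y/x)^a`. [folklore] -/
theorem log_pow_div_rpow_le {a : ℝ} (ha : 0 < a) {k : ℕ} (hk : 1 ≤ k) {x y : ℝ} (hx : 0 < x)
    (hkL : (k : ℝ) / a ≤ Real.log x) (hxy : x ≤ y) :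
    Real.log y ^ k / y ^ a ≤ Real.log x ^ k / x ^ a := by
  have hy : 0 < y := hx.trans_le hxy
  have hk0 : (0 : ℝ) < k := by exact_mod_cast hk
  have hLpos : 0 < Real.log x := lt_of_lt_of_le (div_pos hk0 ha) hkL
  obtain ⟨d, hd⟩ : ∃ d : ℝ, d = Real.log y - Real.log x := ⟨_, rfl⟩
  have hd0 : 0 ≤ d := by rw [hd]; exact sub_nonneg.2 (Real.log_le_log hx hxy)
  have h1 : Real.log y = Real.log x * (1 + d / Real.log x) := by
    field_simp
    linarith
  have hka : (k : ℝ) ≤ a * Real.log x := by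
    have := (div_le_iff₀ ha).1 hkL
    linarith [mul_comm (Real.log x) a]
  have h2 : (1 + d / Real.log x) ^ k ≤ Real.exp (a * d) := by
    calc (1 + d / Real.log x) ^ k ≤ Real.exp (d / Real.log x) ^ k := by
          apply pow_le_pow_left₀ (by positivity)
          linarith [Real.add_one_le_exp (d / Real.log x)]
      _ = Real.exp (k * (d / Real.log x)) := (Real.exp_nat_mul _ _).symm
      _ ≤ Real.exp (a * d) := by
          refine Real.exp_le_exp.2 ?_
          rw [show (k : ℝ) * (d / Real.log x) = k / Real.log x * d by ring]
          refine mul_le_mul_of_nonneg_right ?_ hd0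
          rw [div_le_iff₀ hLpos]
          linarith
  have h3 : Real.exp (a * d) = y ^ a / x ^ a := by
    rw [Real.rpow_def_of_pos hy, Real.rpow_def_of_pos hx, ← Real.exp_sub, hd]
    congr 1
    ring
  have hxa : 0 < x ^ a := Real.rpow_pos_of_pos hx a
  have hya : 0 < y ^ a := Real.rpow_pos_of_pos hy a
  rw [div_le_div_iff₀ hya hxa]
  have hLk : 0 ≤ Real.log x ^ k := by positivity
  calc Real.log y ^ k * x ^ a = Real.log x ^ k * (1 + d / Real.log x) ^ k * x ^ a := by
        rw [h1, mul_pow]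
    _ ≤ Real.log x ^ k * Real.exp (a * d) * x ^ a :=
        mul_le_mul_of_nonneg_right (mul_le_mul_of_nonneg_left h2 hLk) hxa.le
    _ = Real.log x ^ k * y ^ a := by
        rw [h3]
        field_simp

/-- `H₆₄ < 4.743891` (kernel evaluation in `ℚ`; true value `4.7438909…`). [folklore] -/
theorem harmonic_64_lt_d6 : harmonic 64 < 4743891 / 1000000 := by decide +kernel

/-- `γ < 0.58501` (from `γ < H₆₄ − log 64`, Mathlib `eulerMascheroniConstant_lt_eulerMascheroniSeq'`;
the true value is `0.5772156…`). [folklore] -/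
theorem eulerMascheroniConstant_lt_d5 : eulerMascheroniConstant < 0.58501 := by
  have h := Real.eulerMascheroniConstant_lt_eulerMascheroniSeq' 64
  have hH : ((harmonic 64 : ℚ) : ℝ) < ((4743891 / 1000000 : ℚ) : ℝ) := Rat.cast_lt.2 harmonic_64_lt_d6
  have hlog : Real.log ((64 : ℕ) : ℝ) = 6 * Real.log 2 := by
    rw [show ((64 : ℕ) : ℝ) = 2 ^ 6 by norm_num, Real.log_pow]
    norm_num
  unfold Real.eulerMascheroniSeq' at h
  rw [if_neg (by norm_num), hlog] at h
  have h2 := Real.log_two_gt_d9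
  push_cast at hH
  linarith

/-- `log π > 1.1436` (`log π = log 3 + log(π/3) ≥ log 3 + 1 − 3/π`; true value `1.14473`). [folklore] -/
theorem log_pi_gt : (1.1436 : ℝ) < Real.log π := by
  have hπ := Real.pi_gt_d6
  have h3 := Real.log_three_gt_d9
  have hπ0 : 0 < π := Real.pi_pos
  have h1 : Real.log π = Real.log 3 + Real.log (π / 3) := by
    rw [← Real.log_mul (by norm_num) (by positivity)]
    congr 1
    ring
  have h2 : 1 - (π / 3)⁻¹ ≤ Real.log (π / 3) := Real.one_sub_inv_le_log_of_pos (by positivity)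
  have h4 : (π / 3)⁻¹ < 0.95494 := by
    rw [inv_div, div_lt_iff₀ hπ0]
    nlinarith
  linarith

/-- `log π < 1.1459` (`log(π/3) ≤ π/3 − 1`). [folklore] -/
theorem log_pi_lt : Real.log π < 1.1459 := by
  have hπ := Real.pi_lt_d6
  have h3 := Real.log_three_lt_d9
  have h1 : Real.log π = Real.log 3 + Real.log (π / 3) := by
    rw [← Real.log_mul (by norm_num) (by positivity)]
    congr 1
    ring
  have h2 : Real.log (π / 3) ≤ π / 3 - 1 := Real.log_le_sub_one_of_pos (by positivity)
  linarith

/-- `β < 0.0552` (true value `0.0461914…`). [folklore] -/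
theorem nicolasBeta_lt : nicolasBeta < 0.0552 := by
  unfold nicolasBeta
  have := eulerMascheroniConstant_lt_d5
  have := log_pi_gt
  have := Real.log_two_gt_d9
  linarith

/-- `β > −0.04` (crude; only `8 + 4β ≥ 0` is used). [folklore] -/
theorem neg_lt_nicolasBeta : (-0.04 : ℝ) < nicolasBeta := by
  unfold nicolasBeta
  have := Real.one_half_lt_eulerMascheroniSeq_six
  have := Real.strictMono_eulerMascheroniSeq.monotone
  have h6 : Real.eulerMascheroniSeq 6 < eulerMascheroniConstant :=
    Real.eulerMascheroniSeq_lt_eulerMascheroniConstant 6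
  have := log_pi_lt
  have := Real.log_two_lt_d9
  linarith

/-- **Prop. 2.1 from (2.18)** (Nicolas 2012, the step (2.18) ⟹ (2.20) ⟹ (2.16) at `x₀ = 10⁹`: each
second-order term, multiplied by `√x log² x`, is non-increasing for `x ≥ x₀`, and at `x₀` their sum is
`(8+4β)/log x₀ + log(2π) log x₀/√x₀ + 2 log x₀/x₀^{1/6} + log⁵ x₀/(64π² √x₀) ≤ 1.9001 < 2 − β`;
Nicolas's value of the difference is `0.055`). Hence the vendored fact `Nicolas2012_logf_lower` is a
consequence of `Nicolas2012_logf_lower_sharp`. [cite: Nicolas2012, Prop. 2.1, proof ((2.18) ⟹ (2.20) ⟹ (2.16))] -/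
theorem Nicolas2012_logf_lower_of_sharp (h : Nicolas2012_logf_lower_sharp) :
    Nicolas2012_logf_lower := by
  intro hRH x hx
  have hx0 : 0 < x := lt_of_lt_of_le (by norm_num) hx
  have hmain := h hRH x (le_trans (by norm_num) hx)
  set L := Real.log x with hL
  set y := x ^ ((1 : ℝ) / 6) with hy
  have hy0 : 0 < y := Real.rpow_pos_of_pos hx0 _
  have hy3 : y ^ 3 = x ^ ((1 : ℝ) / 2) := by
    rw [hy, ← Real.rpow_mul_natCast hx0.le]; norm_num
  have hy4 : y ^ 4 = x ^ ((2 : ℝ) / 3) := by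
    rw [hy, ← Real.rpow_mul_natCast hx0.le]; norm_num
  have hy6 : y ^ 6 = x := by
    rw [hy, ← Real.rpow_mul_natCast hx0.le]; norm_num
  have hsqrt : √x = y ^ 3 := by rw [hy3, Real.sqrt_eq_rpow]
  -- the anchor `x₀ = 10⁹`
  have hx9 : (0 : ℝ) < 10 ^ 9 := by norm_num
  have hlog9u : Real.log ((10 : ℝ) ^ 9) ≤ 20.72326585 := by
    rw [Real.log_pow, show (10 : ℝ) = 2 * 5 by norm_num, Real.log_mul (by norm_num) (by norm_num)]
    have := Real.log_two_lt_d9; have := Real.log_five_lt_d9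
    push_cast; linarith
  have hlog9l : (20.7232658 : ℝ) ≤ Real.log ((10 : ℝ) ^ 9) := by
    rw [Real.log_pow, show (10 : ℝ) = 2 * 5 by norm_num, Real.log_mul (by norm_num) (by norm_num)]
    have := Real.log_two_gt_d9; have := Real.log_five_gt_d9
    push_cast; linarith
  have hL0 : (20.7232658 : ℝ) ≤ L := hlog9l.trans (Real.log_le_log hx9 hx)
  have hLpos : 0 < L := by linarith
  have hs9 : (31622.776 : ℝ) ≤ ((10 : ℝ) ^ 9) ^ ((1 : ℝ) / 2) := by
    rw [← Real.sqrt_eq_rpow, Real.le_sqrt' (by norm_num : (0 : ℝ) < 31622.776)]; norm_num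
  have hy9 : (31.62277 : ℝ) ≤ ((10 : ℝ) ^ 9) ^ ((1 : ℝ) / 6) := by
    by_contra hlt
    push Not at hlt
    have h6 := pow_lt_pow_left₀ hlt (Real.rpow_nonneg hx9.le _) (by norm_num : (6 : ℕ) ≠ 0)
    rw [← Real.rpow_mul_natCast hx9.le] at h6
    norm_num at h6
  -- the three antitone second-order terms
  have hA2 : L / y ^ 3 ≤ 0.00065533 := by
    have h1 := log_pow_div_rpow_le (a := 1 / 2) (by norm_num) (k := 1) le_rfl hx9
      (le_trans (by norm_num) hlog9l) hx
    rw [pow_one, pow_one] at h1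
    rw [hy3]
    calc L / x ^ ((1 : ℝ) / 2) ≤ Real.log ((10 : ℝ) ^ 9) / ((10 : ℝ) ^ 9) ^ ((1 : ℝ) / 2) := h1
      _ ≤ 20.72326585 / ((10 : ℝ) ^ 9) ^ ((1 : ℝ) / 2) :=
          div_le_div_of_nonneg_right hlog9u (by positivity)
      _ ≤ 20.72326585 / 31622.776 := div_le_div_of_nonneg_left (by norm_num) (by norm_num) hs9
      _ ≤ 0.00065533 := by norm_num
  have hA3 : L / y ≤ 0.655328 := by
    have h1 := log_pow_div_rpow_le (a := 1 / 6) (by norm_num) (k := 1) le_rfl hx9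
      (le_trans (by norm_num) hlog9l) hx
    rw [pow_one, pow_one] at h1
    rw [hy]
    calc L / x ^ ((1 : ℝ) / 6) ≤ Real.log ((10 : ℝ) ^ 9) / ((10 : ℝ) ^ 9) ^ ((1 : ℝ) / 6) := h1
      _ ≤ 20.72326585 / ((10 : ℝ) ^ 9) ^ ((1 : ℝ) / 6) :=
          div_le_div_of_nonneg_right hlog9u (by positivity)
      _ ≤ 20.72326585 / 31.62277 := div_le_div_of_nonneg_left (by norm_num) (by norm_num) hy9
      _ ≤ 0.655328 := by norm_num
  have hA5 : L ^ 5 / y ^ 3 ≤ 120.863 := by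
    have h1 := log_pow_div_rpow_le (a := 1 / 2) (by norm_num) (k := 5) (by norm_num) hx9
      (le_trans (by norm_num) hlog9l) hx
    rw [hy3]
    have h0 : 0 ≤ Real.log ((10 : ℝ) ^ 9) := le_trans (by norm_num) hlog9l
    have hl5 : Real.log ((10 : ℝ) ^ 9) ^ 5 ≤ 20.72326585 ^ 5 := pow_le_pow_left₀ h0 hlog9u 5
    calc L ^ 5 / x ^ ((1 : ℝ) / 2) ≤ Real.log ((10 : ℝ) ^ 9) ^ 5 / ((10 : ℝ) ^ 9) ^ ((1 : ℝ) / 2) := h1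
      _ ≤ 20.72326585 ^ 5 / ((10 : ℝ) ^ 9) ^ ((1 : ℝ) / 2) :=
          div_le_div_of_nonneg_right hl5 (by positivity)
      _ ≤ 20.72326585 ^ 5 / 31622.776 := div_le_div_of_nonneg_left (by norm_num) (by norm_num) hs9
      _ ≤ 120.863 := by norm_num
  -- constants
  have hβ := nicolasBeta_lt
  have hβ' := neg_lt_nicolasBeta
  have hlog2pi : Real.log (2 * π) ≤ 2.08 := by
    have : Real.log (2 * π) ≤ Real.log 8 := Real.log_le_log (by positivity) (by linarith [Real.pi_lt_four])
    rw [show (8 : ℝ) = 2 ^ 3 by norm_num, Real.log_pow] at this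
    have := Real.log_two_lt_d9
    push_cast at *
    linarith
  have hlog2pi0 : 0 ≤ Real.log (2 * π) := Real.log_nonneg (by linarith [Real.pi_gt_three])
  have hpi2 : (9.8696 : ℝ) ≤ π ^ 2 := by nlinarith [Real.pi_gt_d6, Real.pi_pos]
  have hT1 : (8 + 4 * nicolasBeta) / L ≤ (8 + 4 * 0.0552) / 20.7232658 := by
    calc (8 + 4 * nicolasBeta) / L ≤ (8 + 4 * 0.0552) / L :=
          div_le_div_of_nonneg_right (by linarith) hLpos.le
      _ ≤ (8 + 4 * 0.0552) / 20.7232658 := div_le_div_of_nonneg_left (by norm_num) (by norm_num) hL0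
  have hT2 : Real.log (2 * π) * (L / y ^ 3) ≤ 2.08 * 0.00065533 :=
    mul_le_mul hlog2pi hA2 (by positivity) (by norm_num)
  have hT4 : L ^ 5 / y ^ 3 / (64 * π ^ 2) ≤ 120.863 / (64 * 9.8696) := by
    calc L ^ 5 / y ^ 3 / (64 * π ^ 2) ≤ 120.863 / (64 * π ^ 2) :=
          div_le_div_of_nonneg_right hA5 (by positivity)
      _ ≤ 120.863 / (64 * 9.8696) := div_le_div_of_nonneg_left (by norm_num) (by norm_num) (by linarith)
  have key : 0 ≤ (2 - nicolasBeta) - (8 + 4 * nicolasBeta) / L - Real.log (2 * π) * (L / y ^ 3)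
      - 2 * (L / y) - L ^ 5 / y ^ 3 / (64 * π ^ 2) := by
    norm_num at hT1 hT2 hT4 ⊢
    linarith
  -- back to the divided form
  have hR : 0 ≤ (2 - nicolasBeta) / (y ^ 3 * L ^ 2) - (8 + 4 * nicolasBeta) / (y ^ 3 * L ^ 3)
      - Real.log (2 * π) / (x * L) - 2 / (y ^ 4 * L) - L ^ 3 / (64 * π ^ 2 * x) := by
    rw [← hy6]
    have hπ : (0 : ℝ) < π := Real.pi_pos
    have e : (2 - nicolasBeta) / (y ^ 3 * L ^ 2) - (8 + 4 * nicolasBeta) / (y ^ 3 * L ^ 3)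
        - Real.log (2 * π) / (y ^ 6 * L) - 2 / (y ^ 4 * L) - L ^ 3 / (64 * π ^ 2 * y ^ 6) =
        ((2 - nicolasBeta) - (8 + 4 * nicolasBeta) / L - Real.log (2 * π) * (L / y ^ 3)
          - 2 * (L / y) - L ^ 5 / y ^ 3 / (64 * π ^ 2)) / (y ^ 3 * L ^ 2) := by
      field_simp
    rw [e]
    exact div_nonneg key (by positivity)
  rw [hsqrt, ← hy4] at hmain
  rw [hsqrt]
  have hfin : -(nicolasBeta + 2) / (y ^ 3 * L) ≤ Real.log (nicolasF x) := by linarith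
  rw [show (2 + nicolasBeta) / (y ^ 3 * L) = -(-(nicolasBeta + 2) / (y ^ 3 * L)) by ring]
  linarith

end Literature.NumberTheory.LFunctions

end
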